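import Literature.Computability.Cryptography.ChenQuantumLWEClassTwirl
import Literature.Computability.Cryptography.ChenQuantumLWEGeneralMeasurement
import Literature.Computability.Cryptography.ChenQuantumLWECoarsening

/-!
# Datum privacy of Chen's chirped coset state: no measurement of one run reads `v′₀ mod Q` (T10)

REPRODUCTION / ANALYSIS OF A CLAIMED RESULT UNDER ADJUDICATION (withdrawn): Yilei Chen, *Quantum
Algorithms for Lattice Problems*, IACR ePrint 2024/555, version of 2024-04-18 [ChenQuantumLattice2024]
(the version carrying the author's note that Step 9 contains a bug), Step 9 (§3.5.9, pp. 34–38) acting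
on `|φ8.b⟩ = Σ_{j ∈ ℤ_P} e(-j²/P) |2D²j·b + v′ mod N⟩` (p. 35), `P = p₁Q`, `N = D²P`.  Bundle
`papers/QuantumAdvantage/lwe-quantum-autopsy/`, Part 2 (`REPAIR-CENSUS.md` §1 theorem **T10** and §17),
on top of `ChenQuantumLWEClassTwirl.lean` (class shifts, T4), `ChenQuantumLWEGeneralMeasurement.lean`
(`POVM`) and `ChenQuantumLWECoarsening.lean` (fibre count of `ℤ_N → ℤ_Q`).
HONEST FRAMING: kernel-checked THEOREMS about a state occurring in a WITHDRAWN algorithm — a precise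
NEGATIVE result (an information ceiling for a whole class of repairs), NOT summit progress, no
cryptanalytic claim in either direction, no new algorithm; quantum lower bounds are out of scope.

## The question

Step 9 consumes the datum `v′₀ mod D²P` of the run's fresh, unknown offset `v′` (p. 37; in the tree
`Shape.step9Needs`); Step 8 certifies only `v′₀ mod D²p₁` (Claim 3.14; `Shape.step8_ceiling_iff`,
`Shape.step8_povm_ceiling`: nothing finer is certified by ANY measurement that returns `|φ7⟩` intact).
The missing part is one residue `a ∈ ℤ_Q`.  Parts 1–2 proved that a NON-DEMOLITION read-out cannot supply
it and that an offset-OBLIVIOUS processing is secret-blind (T4); Part 1's read-out bound (module (R)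
`ChenQuantumLWEReadoutBound`, `Shape.step9Needs_readout_le`) shows that no POVM + decoder on the STEP-8
register `|φ7.d⟩` outputs the datum with probability above `pairsCount(Q)/Q² < 2/3` on every instance
(one dummy unknown slope), leaving the true order open ("conceivably `O(1/Q)`", its handoff (σ′)).  The
question here (`REPAIR-CENSUS.md` §6, the "or the quantum registers" clause; Part 1 (σ)/(σ′)) is the one a
replacement of Step 9 faces: Steps 1–8 run as printed, and an ARBITRARY — demolishing, collective over all
`n+1` registers, secret-ignorant — measurement of the state Step 9 RECEIVES tries to READ `a`.  Can it
succeed with probability between chance `1/Q` and `1`?  Answer: only by `(1 − 1/Q)·π_B` above chance,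
`π_B = Q^{-m}` for prime `Q` with `m` unknown coordinates — and this is attained (remark below).

## The model and what is proved

Fix the public data `n, D, p₁, Q`, a set `U` of coordinates on which `b` is unknown (eq. (12) p. 17: the
LWE secret and error coordinates), ANY integer vector `b` (the instance) and ANY public `bk` agreeing with
`b` off `U`, any offset `v′`.  The secrets of the class are `b + 2p₁·(s·𝟙_U)`, `s ∈ ℤ_Q^{n+1}`
(`secretShift`; only the `U`-coordinates of `s` enter), the offsets are `v′ + d(a,c)` with the class
shifts `d(a,c) = D²p₁(a·bk + c·𝟙_U)` of `ChenQuantumLWEClassTwirl` (`classShift`), and the DATUM is `a`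
(with `bk₀ = b₀ = −1` as in eq. (12), `a` runs over exactly the `Q` candidates for `v′₀ mod D²P` above
Step 8's certificate).  `datumKet a (s,c) = QFT|φ8.(b+2p₁s𝟙_U), v′+d(a,c)⟩` and
`datumGram a = Σ_{s,c} |datumKet a (s,c)⟩⟨datumKet a (s,c)|` (`datumGram`, entries via `fourierGram`) is
the unnormalised state of the Step-9 register GIVEN the datum `a`, averaged over the class.  We prove,
for all parameters (no parity / coprimality unless stated):

* `tailFactor_eq`, `sum_fourierGram_secretShift`, `datumGram_eq_of_ann` — the closed form
  `datumGram a (u,u′) = ψ_Q(a·σ) · Q^{n+1} · Π_i Q·[4σ·ū_i = 0] · ρ̂_{b,v′}(u,u′)` on the entries with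
  `u′ − u ≡ 0 (mod Q)` on `U`, and `0` elsewhere (`datumGram_eq_zero_of_classFreq_ne`); here
  `σ = ⟨b, (u′−u) mod P⟩ mod Q` and `ū_i = u_i mod Q` (`i ∈ U`; `classFreq`).  Mechanism: the `c`-average
  is character orthogonality on `U` (as in T4); the `s`-average is a SECOND orthogonality — the secret
  shift moves the hyperplane functional by `p₁·(2Σ_i s_i u_i)`, and `ψ_P(p₁x) = ψ_Q(x mod Q)`.
* **`datumGram_indep`**: if some `ū_i`, `i ∈ U`, is a unit mod `Q` ("generic" outcome `u`,
  `IsGeneric`) and `4` is a unit mod `Q`, then the whole row `datumGram a (u,·)` does NOT depend on `a`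
  (`σ = 0` is forced on every surviving entry).  **`datumGram_offBlock`**: entries between a generic and a
  non-generic outcome vanish.  `datumGram_self`: the diagonal is `Q^{2(n+1)}·P` (odd `P`, T3).
* `POVM.sum_weight_le_of_blocks` (abstract block lemma, any POVM `E` with outcomes `a`): if a family of
  Gram matrices `ρ_a` is `a`-independent on a block `G × G` and vanishes on `G × Gᶜ`, then
  `Σ_a tr(E_a ρ_a) ≤ tr_G(ρ) + Σ_a tr_{Gᶜ}(ρ_a)` (`E_a ≤ 1`, `E_a ≥ 0`, completeness on `G`).
* **`datum_weight_le`** (T10): for EVERY POVM `E` on the Step-9 register `ℤ_N^{n+1}` with outcomes in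
  `ℤ_Q` (a guess of the datum; any unitary post-processing of all registers followed by any measurement
  is such an `E`), the total Born weight of a correct guess over the uniform class satisfies
  `Σ_a Σ_{s,c} ⟨datumKet a (s,c)| E_a |datumKet a (s,c)⟩ ≤ Q^{2(n+1)}·P·(#G + Q·#Gᶜ)`,
  i.e. (**`datum_success_prob_le`**, normalised by the total weight `Q·Q^{2(n+1)}·P·N^{n+1}`):
  `Pr[guess = a] ≤ 1/Q + (1 − 1/Q)·π_B`, `π_B = #{u : no ū_i (i ∈ U) is a unit}/N^{n+1}`;
  for prime `Q`, `π_B = Q^{-#U}` (`card_nonGeneric_mul_of_prime`), so with `m = #U` unknown coordinates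
  `Pr ≤ 1/Q + (1 − 1/Q)/Q^m` (**`datum_success_prob_le_of_prime`**); worst case over the class
  (**`datum_exists_member_le`**): every member has squared norm `P·N^{n+1}`, so some member `(a,(s,c))`
  has success weight `≤ (1/Q + (1 − 1/Q)·π_B)·P·N^{n+1}` — no `E` beats the bound on EVERY instance.
* `Shape.datum_privacy`, `Shape.datum_privacy_of_prime` — the same for every admissible shape (C.3 gives
  `P` odd), any `U`, any `bk` agreeing with `S.b` off `U`, any offset.

Reading (census T10 / rows G1, G2, §6): within one run, a secret-ignorant measurement of the registers —
of any kind — identifies the missing datum with advantage at most `(1 − 1/Q)·π_B` over the blind guess;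
the only outcomes carrying ANY dependence on the datum are the non-generic ones (`ū ≡ 0` on `U` for prime
`Q`), hit with probability `π_B` whatever is measured (flat spectrum), and on them the dependence is a
pure phase `ψ_Q(a·σ)`.  Together with T4/T5 (wrong datum ⇒ garbage, right datum ⇒ eq. (41)) and the
Step-8 ceilings this closes the "produce `v′₀ mod P` from the registers" clause of the repair checklist
for single-run, secret-ignorant processing of the Step-9 register.  SHARPNESS (remark, by hand, with
numerics in the bundle, `numerics/b2b-lwe-2/gen11_datum_privacy.py`; NOT formalised): the closed form says
`ρ_a = D_a ρ_0 D_a†` with the diagonal unitary `D_a = diag ψ_Q(−a·⟨b̄,ū⟩)`, and on the outcomes with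
`gcd(ū|_U, Q) = g` only `a mod g` survives, perfectly readable when `b̄₀ = −1` is a unit and `0 ∉ U`
(equidistribution of `ū₀`); hence the optimum over all POVMs is exactly `(1/Q)·E_u[gcd(ū|_U, Q)]`
(`u` flat) — for prime `Q` this is `1/Q + (1 − 1/Q)Q^{-m}`, the bound above, and for `m = 1` it is
`pairsCount(Q)/Q²`, the constant of (R); for squarefree `Q`, `(1/Q)·Π_{q ∣ Q}(1 + (q−1)q^{-m})`.

## What is NOT here

Measurements of the Step-8 register BEFORE Step 8's partial measurement ((R)'s larger strategy class —
repairs that also change Step 8; neither (R) nor T10 implies the other); many-run / adaptive strategies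
with a transcript (the datum is fresh per run, so runs do not accumulate information about one run's `a`;
a strategy that first learns the SECRET is Regev's regime and outside this model — census §13,
"circular"); the identification of the class shifts with all secret-ignorant side information (census §0,
by hand); sharpness; the composite-`Q` optimum.  No normalised density matrices are needed: all
statements are about unnormalised weights and the normalisation is the explicit constant
`Q·Q^{2(n+1)}·P·N^{n+1}` (`datum_totalWeight`).

References: [ChenQuantumLattice2024] as above; [ZhangExactCoset2025] Y. Zhang, arXiv:2509.12341, p. 22
(AC4: the datum is what the exact-coset-sampling repair would need); [NielsenChuang2010] §2.2.6 (POVMs),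
Box 2.3 / §9.2 (state discrimination); [Korobov1992] Ch. I §3 (Gauss sums, via T3).
-/

namespace Literature.Computability.Cryptography.Chen2024

open scoped BigOperators ComplexOrder
open Matrix

/-! ### 1. Gram matrices of ket families; a block lemma for POVMs -/

section KetGram

variable {X I : Type*} [Fintype I]

/-- The (unnormalised) Gram / density matrix of a finite family of kets:
`ρ(x,x′) = Σ_i ψ_i(x)·conj ψ_i(x′)` (the matrix of `Σ_i |ψ_i⟩⟨ψ_i|`).
[cite: NielsenChuang2010, §2.4.1 p. 99] -/
def ketGram (ψ : I → X → ℂ) (x x' : X) : ℂ := ∑ i, ψ i x * (starRingEnd ℂ) (ψ i x')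

/-- A Gram matrix is Hermitian. [cite: NielsenChuang2010, §2.4.1 p. 99] -/
theorem conj_ketGram (ψ : I → X → ℂ) (x x' : X) :
    (starRingEnd ℂ) (ketGram ψ x x') = ketGram ψ x' x := by
  unfold ketGram
  rw [map_sum]
  refine Finset.sum_congr rfl fun i _ => ?_
  rw [map_mul, Complex.conj_conj, mul_comm]

variable [Fintype X] [DecidableEq X] {A : Type*} [Fintype A]

/-- `⟨ψ|E_a|ψ⟩ = Σ_{x,x′} conj ψ(x)·E_a(x,x′)·ψ(x′)`. [cite: NielsenChuang2010, §2.2.6 p. 90] -/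
theorem POVM.weight_eq_sum (E : POVM X A) (ψ : X → ℂ) (a : A) :
    E.weight ψ a = ∑ x, ∑ x', (starRingEnd ℂ) (ψ x) * E.effect a x x' * ψ x' := by
  unfold POVM.weight
  simp only [dotProduct, mulVec, Pi.star_apply, Complex.star_def, Finset.mul_sum, mul_assoc]

/-- `Σ_i ⟨ψ_i|E_a|ψ_i⟩ = Σ_{x,x′} E_a(x,x′)·ρ(x′,x) = tr(E_a ρ)` for the Gram matrix `ρ` of the family.
[cite: NielsenChuang2010, §2.4.1 p. 99] -/
theorem POVM.sum_weight_eq_gram (E : POVM X A) (ψ : I → X → ℂ) (a : A) :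
    ∑ i, E.weight (ψ i) a = ∑ x, ∑ x', E.effect a x x' * ketGram ψ x' x := by
  simp_rw [POVM.weight_eq_sum]
  rw [Finset.sum_comm]
  refine Finset.sum_congr rfl fun x _ => ?_
  rw [Finset.sum_comm]
  refine Finset.sum_congr rfl fun x' _ => ?_
  rw [ketGram, Finset.mul_sum]
  refine Finset.sum_congr rfl fun i _ => ?_
  ring

/-- The effects of a POVM sum to `1` entrywise. [cite: NielsenChuang2010, §2.2.6 p. 90] -/
theorem POVM.sum_effect_apply (E : POVM X A) (x x' : X) :
    ∑ a, E.effect a x x' = if x = x' then 1 else 0 := by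
  rw [← Matrix.sum_apply, E.sum_eq_one, Matrix.one_apply]

/-- **Block lemma (state discrimination with a common block).**  Let `ρ_a` (`a ∈ A`) be the Gram
matrices of ket families `q a`, and `G` a set of basis states such that on `G × G` the entries of `ρ_a`
do not depend on `a` and the entries `G × Gᶜ` vanish.  Then for every POVM `E` with outcomes in `A`
`Σ_a tr(E_a ρ_a) ≤ tr_G(ρ_{a₀}) + Σ_a tr_{Gᶜ}(ρ_a)`: on the common block completeness `Σ_a E_a = 1`
gives exactly the `G`-trace, on the complement `0 ≤ E_a ≤ 1` bounds each term by the full `Gᶜ`-trace.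
[cite: NielsenChuang2010, §2.2.6 p. 90, Box 2.3 p. 87] -/
theorem POVM.sum_weight_le_of_blocks [DecidableEq A] (E : POVM X A) (q : A → I → X → ℂ)
    (G : X → Prop) [DecidablePred G] (a₀ : A)
    (hGG : ∀ a x x', G x → G x' → ketGram (q a) x x' = ketGram (q a₀) x x')
    (hGB : ∀ a x x', G x → ¬ G x' → ketGram (q a) x x' = 0) :
    ∑ a, ∑ i, E.weight (q a i) a
      ≤ ∑ x ∈ Finset.univ.filter G, ketGram (q a₀) x x
        + ∑ a, ∑ x ∈ Finset.univ.filter (fun x => ¬ G x), ketGram (q a) x x := by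
  -- mixed entries vanish in both orders (Hermitian symmetry)
  have hBG : ∀ a x x', ¬ G x → G x' → ketGram (q a) x x' = 0 := fun a x x' hx hx' => by
    rw [← conj_ketGram, hGB a x' x hx' hx, map_zero]
  -- the kets restricted to the complement of `G`
  set qB : A → I → X → ℂ := fun a i x => if G x then 0 else q a i x with hqB
  have hgramB : ∀ a x x', ketGram (qB a) x x' = if ¬ G x ∧ ¬ G x' then ketGram (q a) x x' else 0 := by
    intro a x x'
    unfold ketGram
    split_ifs with h
    · simp only [hqB, if_neg h.1, if_neg h.2]
    · rw [not_and_or, not_not, not_not] at h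
      refine Finset.sum_eq_zero fun i _ => ?_
      rcases h with h | h
      · simp only [hqB, if_pos h, zero_mul]
      · simp only [hqB, if_pos h, map_zero, mul_zero]
  -- entrywise block decomposition of `ρ_a`
  have hsplit : ∀ a x x', ketGram (q a) x' x
      = (if G x' ∧ G x then ketGram (q a₀) x' x else 0) + ketGram (qB a) x' x := by
    intro a x x'
    rw [hgramB]
    by_cases hx : G x <;> by_cases hx' : G x'
    · rw [if_pos ⟨hx', hx⟩, if_neg (fun h => h.1 hx'), add_zero, hGG a x' x hx' hx]
    · rw [if_neg (fun h => hx' h.1), if_neg (fun h => h.2 hx), add_zero, hBG a x' x hx' hx]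
    · rw [if_neg (fun h => hx h.2), if_neg (fun h => h.1 hx'), add_zero, hGB a x' x hx' hx]
    · rw [if_neg (fun h => hx h.2), if_pos ⟨hx', hx⟩, zero_add]
  -- per outcome: common-block term + weight of the restricted kets
  have hW : ∀ a, ∑ i, E.weight (q a i) a
      = ∑ x, ∑ x', E.effect a x x' * (if G x' ∧ G x then ketGram (q a₀) x' x else 0)
        + ∑ i, E.weight (qB a i) a := by
    intro a
    rw [E.sum_weight_eq_gram, E.sum_weight_eq_gram, ← Finset.sum_add_distrib]
    refine Finset.sum_congr rfl fun x _ => ?_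
    rw [← Finset.sum_add_distrib]
    refine Finset.sum_congr rfl fun x' _ => ?_
    rw [hsplit, mul_add]
  -- the common block: completeness gives the `G`-trace exactly
  have hGsum : ∑ a, ∑ x, ∑ x', E.effect a x x' * (if G x' ∧ G x then ketGram (q a₀) x' x else 0)
      = ∑ x ∈ Finset.univ.filter G, ketGram (q a₀) x x := by
    have hx : ∀ x, ∑ a, ∑ x', E.effect a x x' * (if G x' ∧ G x then ketGram (q a₀) x' x else 0)
        = if G x then ketGram (q a₀) x x else 0 := by
      intro x
      rw [Finset.sum_comm]
      simp_rw [← Finset.sum_mul, E.sum_effect_apply, ite_mul, one_mul, zero_mul]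
      rw [Finset.sum_ite_eq, if_pos (Finset.mem_univ x)]
      simp only [and_self]
    rw [Finset.sum_comm, Finset.sum_congr rfl fun x _ => hx x, Finset.sum_filter]
  -- the complement block: `⟨q^B|E_a|q^B⟩ ≤ Σ_{a′} ⟨q^B|E_{a′}|q^B⟩ = ‖q^B‖²`
  have hB : ∀ a, ∑ i, E.weight (qB a i) a
      ≤ ∑ x ∈ Finset.univ.filter (fun x => ¬ G x), ketGram (q a) x x := by
    intro a
    calc ∑ i, E.weight (qB a i) a
        ≤ ∑ i, ∑ a', E.weight (qB a i) a' :=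
          Finset.sum_le_sum fun i _ =>
            Finset.single_le_sum (fun a' _ => E.weight_nonneg (qB a i) a') (Finset.mem_univ a)
      _ = ∑ i, star (qB a i) ⬝ᵥ qB a i := Finset.sum_congr rfl fun i _ => E.sum_weight _
      _ = ∑ x ∈ Finset.univ.filter (fun x => ¬ G x), ketGram (q a) x x := by
          simp only [dotProduct, Pi.star_apply, Complex.star_def]
          rw [Finset.sum_comm, Finset.sum_filter]
          refine Finset.sum_congr rfl fun x _ => ?_
          by_cases hx : G x
          · rw [if_neg (not_not.2 hx)]
            refine Finset.sum_eq_zero fun i _ => ?_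
            simp only [hqB, if_pos hx, mul_zero]
          · rw [if_pos hx, ketGram]
            refine Finset.sum_congr rfl fun i _ => ?_
            simp only [hqB, if_neg hx]
            rw [mul_comm]
  calc ∑ a, ∑ i, E.weight (q a i) a
      = ∑ a, (∑ x, ∑ x', E.effect a x x' * (if G x' ∧ G x then ketGram (q a₀) x' x else 0)
          + ∑ i, E.weight (qB a i) a) := Finset.sum_congr rfl fun a _ => hW a
    _ = ∑ x ∈ Finset.univ.filter G, ketGram (q a₀) x x + ∑ a, ∑ i, E.weight (qB a i) a := by
          rw [Finset.sum_add_distrib, hGsum]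
    _ ≤ ∑ x ∈ Finset.univ.filter G, ketGram (q a₀) x x
          + ∑ a, ∑ x ∈ Finset.univ.filter (fun x => ¬ G x), ketGram (q a) x x :=
          add_le_add le_rfl (Finset.sum_le_sum fun a _ => hB a)

end KetGram

/-! ### 2. The class of one instance with the datum singled out -/

section Datum

variable (n : ℕ) (D p₁ Q : ℕ+)

/-- For odd `P = p₁Q` (Cond. C.3), `4` is a unit of `ℤ_Q`. [folklore] -/
theorem isUnit_four_of_odd (hP : Odd ((p₁ * Q : ℕ+) : ℕ)) : IsUnit (4 : ZQ Q) := by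
  rw [PNat.mul_coe] at hP
  have h2Q : Nat.Coprime 2 ((Q : ℕ+) : ℕ) := Nat.coprime_two_left.2 (Nat.Odd.of_mul_right hP)
  have h := (ZMod.isUnit_iff_coprime (2 ^ 2) ((Q : ℕ+) : ℕ)).2 (h2Q.pow_left 2)
  rw [Nat.cast_pow, Nat.cast_ofNat] at h
  norm_num at h
  exact h

/-- The secret shifts of the class: `2p₁·(s·𝟙_U)` with `s ∈ ℤ_Q^{n+1}` lifted to `[0,Q)` (only the
`U`-coordinates enter) — the secrets `b + 2p₁(s·𝟙_U)` share the planted part of `b` and differ in the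
unknown coordinates by the `2p₁`-multiples of eq. (12). [cite: ChenQuantumLattice2024, eq. (12) p. 17] -/
def secretShift (U : Finset (Fin (n + 1))) (s : Fin (n + 1) → ZQ Q) : Fin (n + 1) → ℤ :=
  fun i => 2 * ((p₁ : ℕ) : ℤ) * ((classTail n Q U s i : ℕ) : ℤ)

/-- The functional by which a secret shift moves the hyperplane functional:
`L_s(u) = Σ_{i ∈ U} s_i·(u_i mod P)` (so `lineFun (b + 2p₁s𝟙_U) = lineFun b + p₁·2L_s`). [folklore] -/
def tailLin (U : Finset (Fin (n + 1))) (s : Fin (n + 1) → ZQ Q) (u : Fin (n + 1) → ZN D p₁ Q) : ZP p₁ Q :=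
  ∑ i, ((classTail n Q U s i : ℕ) : ZP p₁ Q) * toP D (p₁ * Q) (u i)

/-- `lineFun (b + 2p₁(s·𝟙_U)) u = lineFun b u + p₁·(2 L_s(u))`. [folklore] -/
theorem lineFun_add_secretShift (U : Finset (Fin (n + 1))) (b : Fin (n + 1) → ℤ) (s : Fin (n + 1) → ZQ Q)
    (u : Fin (n + 1) → ZN D p₁ Q) :
    lineFun n D p₁ Q (b + secretShift n p₁ Q U s) u
      = lineFun n D p₁ Q b u + ((p₁ : ℕ) : ZP p₁ Q) * (2 * tailLin n D p₁ Q U s u) := by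
  unfold lineFun tailLin
  rw [Finset.mul_sum, Finset.mul_sum, ← Finset.sum_add_distrib]
  refine Finset.sum_congr rfl fun i _ => ?_
  simp only [Pi.add_apply, secretShift, Int.cast_add, Int.cast_mul, Int.cast_ofNat, Int.cast_natCast]
  ring

/-- `L_s(u) mod Q = Σ_i s_i·ū_i` with `ū_i = classFreq_i(u)` (`= u_i mod Q` on `U`, `0` off `U`).
[folklore] -/
theorem toQ_tailLin (U : Finset (Fin (n + 1))) (s : Fin (n + 1) → ZQ Q) (u : Fin (n + 1) → ZN D p₁ Q) :
    toQ p₁ Q (tailLin n D p₁ Q U s u) = ∑ i, s i * classFreq n D p₁ Q U u i := by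
  unfold tailLin
  rw [map_sum]
  refine Finset.sum_congr rfl fun i _ => ?_
  rw [map_mul, map_natCast]
  unfold classTail classFreq
  split_ifs with hi
  · rw [ZMod.natCast_zmod_val]
  · rw [Nat.cast_zero, zero_mul, mul_zero]

/-- On a difference `η` with `η_i ≡ 0 (mod Q)` for `i ∈ U`, `p₁·L_s(η) = 0` in `ℤ_P` (`p₁·Q = 0`).
[folklore] -/
theorem p₁_mul_tailLin_eq_zero (U : Finset (Fin (n + 1))) (s : Fin (n + 1) → ZQ Q)
    (η : Fin (n + 1) → ZN D p₁ Q) (hcoord : ∀ i ∈ U, classFreq n D p₁ Q U η i = 0) :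
    ((p₁ : ℕ) : ZP p₁ Q) * tailLin n D p₁ Q U s η = 0 := by
  unfold tailLin
  rw [Finset.mul_sum]
  refine Finset.sum_eq_zero fun i _ => ?_
  by_cases hi : i ∈ U
  · have h0 : toQ p₁ Q (toP D (p₁ * Q) (η i)) = 0 := by
      have h := hcoord i hi
      unfold classFreq at h
      rwa [if_pos hi] at h
    obtain ⟨y, hy⟩ := exists_eq_Q_mul_of_toQ_eq_zero p₁ Q h0
    rw [hy]
    have hP := p₁_mul_Q_eq_zero p₁ Q
    linear_combination ((classTail n Q U s i : ℕ) : ZP p₁ Q) * y * hP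
  · unfold classTail
    rw [if_neg hi, Nat.cast_zero, zero_mul, mul_zero]

/-- **The secret shift acts by a phase on the surviving entries.**  If `u′ − u ≡ 0 (mod Q)` on `U`, then
`ρ̂_{b+2p₁s𝟙_U, v′}(u,u′) = ψ_Q(−4σ·Σ_i s_i ū_i) · ρ̂_{b,v′}(u,u′)`, `σ = ⟨b,(u′−u) mod P⟩ mod Q`:
in `t_s(u)² − t_s(u′)²` the shift survives only through `p₁·(−4·t(u′−u)·L_s(u))`, and
`ψ_P(p₁x) = ψ_Q(x mod Q)`. [cite: ChenQuantumLattice2024, §3.5.9 p. 35, eq. (12) p. 17] -/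
theorem fourierGram_secretShift (U : Finset (Fin (n + 1))) (b v' : Fin (n + 1) → ℤ)
    (s : Fin (n + 1) → ZQ Q) (u u' : Fin (n + 1) → ZN D p₁ Q)
    (hcoord : ∀ i ∈ U, classFreq n D p₁ Q U (u' - u) i = 0) :
    fourierGram n D p₁ Q (b + secretShift n p₁ Q U s) v' u u'
      = ZMod.stdAddChar (-(4 * toQ p₁ Q (lineFun n D p₁ Q b (u' - u))
            * ∑ i, s i * classFreq n D p₁ Q U u i))
        * fourierGram n D p₁ Q b v' u u' := by
  have e1 : lineFun n D p₁ Q b u' = lineFun n D p₁ Q b u + lineFun n D p₁ Q b (u' - u) := by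
    rw [← lineFun_sub n D p₁ Q b u u']
    ring
  have e2 := lineFun_add_secretShift n D p₁ Q U b s u
  have e3 : lineFun n D p₁ Q (b + secretShift n p₁ Q U s) u'
      = lineFun n D p₁ Q (b + secretShift n p₁ Q U s) u + lineFun n D p₁ Q b (u' - u) := by
    have h := lineFun_sub n D p₁ Q (b + secretShift n p₁ Q U s) u u'
    have h2 := lineFun_add_secretShift n D p₁ Q U b s (u' - u)
    have hz := p₁_mul_tailLin_eq_zero n D p₁ Q U s (u' - u) hcoord
    linear_combination h + h2 + (2 : ZP p₁ Q) * hz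
  have key : lineFun n D p₁ Q (b + secretShift n p₁ Q U s) u ^ 2
        - lineFun n D p₁ Q (b + secretShift n p₁ Q U s) u' ^ 2
      = (lineFun n D p₁ Q b u ^ 2 - lineFun n D p₁ Q b u' ^ 2)
        + ((p₁ : ℕ) : ZP p₁ Q) * (-(4 * lineFun n D p₁ Q b (u' - u) * tailLin n D p₁ Q U s u)) := by
    rw [e3, e2, e1]
    ring
  rw [fourierGram_eq, fourierGram_eq, key, AddChar.map_add_eq_mul, stdAddChar_p₁_mul]
  simp only [map_neg, map_mul, map_ofNat, toQ_tailLin]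
  ring

/-- **Second orthogonality (average over the secrets of the class).**  On the surviving entries,
`Σ_s ρ̂_{b+2p₁s𝟙_U, v′}(u,u′) = Π_i Q·[4σ·ū_i = 0] · ρ̂_{b,v′}(u,u′)`. [folklore] -/
theorem sum_fourierGram_secretShift (U : Finset (Fin (n + 1))) (b v' : Fin (n + 1) → ℤ)
    (u u' : Fin (n + 1) → ZN D p₁ Q) (hcoord : ∀ i ∈ U, classFreq n D p₁ Q U (u' - u) i = 0) :
    ∑ s : Fin (n + 1) → ZQ Q, fourierGram n D p₁ Q (b + secretShift n p₁ Q U s) v' u u'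
      = (∏ i, (if 4 * toQ p₁ Q (lineFun n D p₁ Q b (u' - u)) * classFreq n D p₁ Q U u i = 0
            then ((((Q : ℕ+) : ℕ) : ℂ)) else 0))
        * fourierGram n D p₁ Q b v' u u' := by
  simp_rw [fourierGram_secretShift n D p₁ Q U b v' _ u u' hcoord]
  rw [← Finset.sum_mul]
  congr 1
  have hterm : ∀ s : Fin (n + 1) → ZQ Q,
      (ZMod.stdAddChar (-(4 * toQ p₁ Q (lineFun n D p₁ Q b (u' - u))
          * ∑ i, s i * classFreq n D p₁ Q U u i)) : ℂ)
        = ∏ i, (ZMod.stdAddChar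
            (s i * -(4 * toQ p₁ Q (lineFun n D p₁ Q b (u' - u)) * classFreq n D p₁ Q U u i)) : ℂ) := by
    intro s
    rw [← stdAddChar_finset_sum]
    congr 1
    rw [Finset.mul_sum, ← Finset.sum_neg_distrib]
    refine Finset.sum_congr rfl fun i _ => ?_
    ring
  simp_rw [hterm]
  rw [(Fintype.prod_sum fun i (y : ZQ Q) => (ZMod.stdAddChar
      (y * -(4 * toQ p₁ Q (lineFun n D p₁ Q b (u' - u)) * classFreq n D p₁ Q U u i)) : ℂ)).symm]
  refine Finset.prod_congr rfl fun i _ => ?_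
  rw [AddChar.sum_mulShift _ (ZMod.isPrimitive_stdAddChar _), ZMod.card, Nat.cast_ite, Nat.cast_zero]
  simp only [neg_eq_zero]

/-- **First orthogonality (average over the offsets with a fixed datum).**
`Σ_c ψ_N(⟨d(a,c), η⟩) = ψ_Q(a·(⟨bk,η mod P⟩ mod Q)) · Π_i Q·[classFreq_i(η) = 0]` — the `c`-part of the
twirl factor of T4 with the datum `a` NOT averaged. [folklore] -/
theorem tailFactor_eq (U : Finset (Fin (n + 1))) (bk : Fin (n + 1) → ℤ) (a : ZQ Q)
    (η : Fin (n + 1) → ZN D p₁ Q) :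
    ∑ c : Fin (n + 1) → ZQ Q, (ZMod.stdAddChar (offsetFun n D p₁ Q (classShift n D p₁ Q U bk a c) η) : ℂ)
      = ZMod.stdAddChar (a * toQ p₁ Q (lineFun n D p₁ Q bk η))
        * ∏ i, (if classFreq n D p₁ Q U η i = 0 then ((((Q : ℕ+) : ℕ) : ℂ)) else 0) := by
  simp_rw [stdAddChar_offsetFun_classShift]
  rw [← Finset.mul_sum]
  congr 1
  rw [(Fintype.prod_sum fun i (y : ZQ Q) => (ZMod.stdAddChar (y * classFreq n D p₁ Q U η i) : ℂ)).symm]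
  refine Finset.prod_congr rfl fun i _ => ?_
  rw [AddChar.sum_mulShift _ (ZMod.isPrimitive_stdAddChar _), ZMod.card, Nat.cast_ite, Nat.cast_zero]

/-- **The state given the datum.**  `datumGram a (u,u′) = Σ_{s,c} ρ̂_{b+2p₁s𝟙_U, v′+d(a,c)}(u,u′)`: the
(unnormalised) Fourier-side density matrix of the run, averaged over the secrets of the class and over
the offsets of the class that carry the datum `a`. [cite: ChenQuantumLattice2024, §3.5.9 pp. 35–37] -/
noncomputable def datumGram (U : Finset (Fin (n + 1))) (bk b v' : Fin (n + 1) → ℤ) (a : ZQ Q)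
    (u u' : Fin (n + 1) → ZN D p₁ Q) : ℂ :=
  ∑ s : Fin (n + 1) → ZQ Q, ∑ c : Fin (n + 1) → ZQ Q,
    fourierGram n D p₁ Q (b + secretShift n p₁ Q U s) (v' + classShift n D p₁ Q U bk a c) u u'

/-- The offset average factors out of every entry (translation covariance + first orthogonality).
[folklore] -/
theorem datumGram_eq_mul_sum (U : Finset (Fin (n + 1))) (bk b v' : Fin (n + 1) → ℤ) (a : ZQ Q)
    (u u' : Fin (n + 1) → ZN D p₁ Q) :
    datumGram n D p₁ Q U bk b v' a u u'
      = (ZMod.stdAddChar (a * toQ p₁ Q (lineFun n D p₁ Q bk (u' - u)))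
          * ∏ i, (if classFreq n D p₁ Q U (u' - u) i = 0 then ((((Q : ℕ+) : ℕ) : ℂ)) else 0))
        * ∑ s : Fin (n + 1) → ZQ Q, fourierGram n D p₁ Q (b + secretShift n p₁ Q U s) v' u u' := by
  unfold datumGram
  simp_rw [fourierGram_shift, ← Finset.sum_mul, tailFactor_eq]
  rw [← Finset.mul_sum]

/-- Entries off the coordinate annihilator vanish: `datumGram a (u,u′) = 0` unless `u′ ≡ u (mod Q)` on `U`.
[folklore] -/
theorem datumGram_eq_zero_of_classFreq_ne (U : Finset (Fin (n + 1))) (bk b v' : Fin (n + 1) → ℤ)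
    (a : ZQ Q) (u u' : Fin (n + 1) → ZN D p₁ Q) {i : Fin (n + 1)}
    (hi : classFreq n D p₁ Q U (u' - u) i ≠ 0) : datumGram n D p₁ Q U bk b v' a u u' = 0 := by
  rw [datumGram_eq_mul_sum, Finset.prod_eq_zero (Finset.mem_univ i) (if_neg hi), mul_zero, zero_mul]

/-- **Closed form on the annihilator.**  If `u′ ≡ u (mod Q)` on `U` and `bk = b` off `U`, then
`datumGram a (u,u′) = ψ_Q(a·σ) · Q^{n+1} · Π_i Q·[4σ·ū_i = 0] · ρ̂_{b,v′}(u,u′)` with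
`σ = ⟨b,(u′−u) mod P⟩ mod Q`: the datum enters through the phase `ψ_Q(a·σ)` ONLY, and the secret average
kills the entry unless `4σ·ū_i = 0` for every `i ∈ U`.
[cite: ChenQuantumLattice2024, §3.5.9 pp. 35–37, eq. (12) p. 17] -/
theorem datumGram_eq_of_ann (U : Finset (Fin (n + 1))) (bk b v' : Fin (n + 1) → ℤ)
    (hbk : ∀ i, i ∉ U → bk i = b i) (a : ZQ Q) (u u' : Fin (n + 1) → ZN D p₁ Q)
    (hcoord : ∀ i ∈ U, classFreq n D p₁ Q U (u' - u) i = 0) :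
    datumGram n D p₁ Q U bk b v' a u u'
      = ZMod.stdAddChar (a * toQ p₁ Q (lineFun n D p₁ Q b (u' - u)))
        * ((((Q : ℕ+) : ℕ) : ℂ)) ^ (n + 1)
        * (∏ i, (if 4 * toQ p₁ Q (lineFun n D p₁ Q b (u' - u)) * classFreq n D p₁ Q U u i = 0
            then ((((Q : ℕ+) : ℕ) : ℂ)) else 0))
        * fourierGram n D p₁ Q b v' u u' := by
  have hall : ∀ i, classFreq n D p₁ Q U (u' - u) i = 0 := fun i => by
    by_cases hi : i ∈ U
    · exact hcoord i hi
    · unfold classFreq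
      rw [if_neg hi]
  have hcoord' : ∀ i ∈ U, toQ p₁ Q (toP D (p₁ * Q) ((u' - u) i)) = 0 := fun i hi => by
    have h := hcoord i hi
    unfold classFreq at h
    rwa [if_pos hi] at h
  rw [datumGram_eq_mul_sum, sum_fourierGram_secretShift n D p₁ Q U b v' u u' hcoord,
    ← toQ_lineFun_eq n D p₁ Q U b bk hbk (u' - u) hcoord']
  simp only [hall, if_true, Finset.prod_const, Finset.card_univ, Fintype.card_fin]
  ring

/-- A Fourier outcome `u` is GENERIC (for `U`) if some `ū_i = u_i mod Q`, `i ∈ U`, is a unit of `ℤ_Q`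
(for prime `Q`: some `u_i ≢ 0 (mod Q)`, `i ∈ U`). [folklore] -/
def IsGeneric (U : Finset (Fin (n + 1))) (u : Fin (n + 1) → ZN D p₁ Q) : Prop :=
  ∃ i ∈ U, IsUnit (classFreq n D p₁ Q U u i)

/-- On the annihilator the residues `ū_i`, `i ∈ U`, of `u` and `u′` agree. [folklore] -/
theorem classFreq_eq_of_ann (U : Finset (Fin (n + 1))) (u u' : Fin (n + 1) → ZN D p₁ Q)
    (hcoord : ∀ i ∈ U, classFreq n D p₁ Q U (u' - u) i = 0) (i : Fin (n + 1)) (hi : i ∈ U) :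
    classFreq n D p₁ Q U u' i = classFreq n D p₁ Q U u i := by
  have h := hcoord i hi
  unfold classFreq at h ⊢
  rw [if_pos hi] at h ⊢
  rw [if_pos hi]
  rwa [Pi.sub_apply, map_sub, map_sub, sub_eq_zero] at h

/-- Hence genericity is constant along the annihilator. [folklore] -/
theorem isGeneric_iff_of_ann (U : Finset (Fin (n + 1))) (u u' : Fin (n + 1) → ZN D p₁ Q)
    (hcoord : ∀ i ∈ U, classFreq n D p₁ Q U (u' - u) i = 0) :
    IsGeneric n D p₁ Q U u ↔ IsGeneric n D p₁ Q U u' := by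
  unfold IsGeneric
  constructor
  · rintro ⟨i, hi, h⟩
    exact ⟨i, hi, by rwa [classFreq_eq_of_ann n D p₁ Q U u u' hcoord i hi]⟩
  · rintro ⟨i, hi, h⟩
    exact ⟨i, hi, by rwa [← classFreq_eq_of_ann n D p₁ Q U u u' hcoord i hi]⟩

/-- **Generic rows do not see the datum.**  If `u` is generic and `4` is a unit mod `Q` (e.g. `Q` odd),
the row `datumGram a (u, ·)` is the same for all data `a, a′`: on a surviving entry `4σ·ū_i = 0` with
`ū_i` a unit forces `σ = 0`, so the phase `ψ_Q(a·σ)` is `1`.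
[cite: ChenQuantumLattice2024, §3.5.9 pp. 35–37] -/
theorem datumGram_indep (U : Finset (Fin (n + 1))) (bk b v' : Fin (n + 1) → ℤ)
    (hbk : ∀ i, i ∉ U → bk i = b i) (h4 : IsUnit (4 : ZQ Q)) {u : Fin (n + 1) → ZN D p₁ Q}
    (hu : IsGeneric n D p₁ Q U u) (a a' : ZQ Q) (u' : Fin (n + 1) → ZN D p₁ Q) :
    datumGram n D p₁ Q U bk b v' a u u' = datumGram n D p₁ Q U bk b v' a' u u' := by
  by_cases hcoord : ∀ i ∈ U, classFreq n D p₁ Q U (u' - u) i = 0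
  · rw [datumGram_eq_of_ann n D p₁ Q U bk b v' hbk a u u' hcoord,
      datumGram_eq_of_ann n D p₁ Q U bk b v' hbk a' u u' hcoord]
    by_cases hσ : toQ p₁ Q (lineFun n D p₁ Q b (u' - u)) = 0
    · simp only [hσ, mul_zero]
    · obtain ⟨i, hi, hunit⟩ := hu
      have hne : 4 * toQ p₁ Q (lineFun n D p₁ Q b (u' - u)) * classFreq n D p₁ Q U u i ≠ 0 :=
        fun h0 => hσ (h4.mul_right_eq_zero.1 (hunit.mul_left_eq_zero.1 h0))
      rw [Finset.prod_eq_zero (Finset.mem_univ i) (if_neg hne)]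
      simp only [mul_zero, zero_mul]
  · push Not at hcoord
    obtain ⟨i, -, hi⟩ := hcoord
    rw [datumGram_eq_zero_of_classFreq_ne n D p₁ Q U bk b v' a u u' hi,
      datumGram_eq_zero_of_classFreq_ne n D p₁ Q U bk b v' a' u u' hi]

/-- **No coherence between generic and non-generic outcomes**: `datumGram a (u,u′) = 0` whenever exactly
one of `u, u′` is generic. [folklore] -/
theorem datumGram_offBlock (U : Finset (Fin (n + 1))) (bk b v' : Fin (n + 1) → ℤ) (a : ZQ Q)
    {u u' : Fin (n + 1) → ZN D p₁ Q} (h : ¬ (IsGeneric n D p₁ Q U u ↔ IsGeneric n D p₁ Q U u')) :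
    datumGram n D p₁ Q U bk b v' a u u' = 0 := by
  by_cases hcoord : ∀ i ∈ U, classFreq n D p₁ Q U (u' - u) i = 0
  · exact absurd (isGeneric_iff_of_ann n D p₁ Q U u u' hcoord) h
  · push Not at hcoord
    obtain ⟨i, -, hi⟩ := hcoord
    exact datumGram_eq_zero_of_classFreq_ne n D p₁ Q U bk b v' a u u' hi

/-- The diagonal: `datumGram a (u,u) = Q^{n+1}·Q^{n+1}·P` for every `u` and `a` (odd `P`; flat spectrum
T3 for each of the `Q^{n+1}·Q^{n+1}` members). [cite: ChenQuantumLattice2024, §3.5.9 p. 35] -/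
theorem datumGram_self (hP : Odd ((p₁ * Q : ℕ+) : ℕ)) (U : Finset (Fin (n + 1)))
    (bk b v' : Fin (n + 1) → ℤ) (a : ZQ Q) (u : Fin (n + 1) → ZN D p₁ Q) :
    datumGram n D p₁ Q U bk b v' a u u
      = ((((Q : ℕ+) : ℕ) : ℂ)) ^ (n + 1) * ((((Q : ℕ+) : ℕ) : ℂ)) ^ (n + 1)
        * ((((p₁ * Q : ℕ+) : ℕ) : ℂ)) := by
  unfold datumGram
  simp only [fourierGram_self n D p₁ Q hP, Finset.sum_const, Finset.card_univ, Fintype.card_fun,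
    ZMod.card, Fintype.card_fin, nsmul_eq_mul, Nat.cast_pow]
  ring

/-! ### 3. T10: no measurement of the run reads the datum -/

/-- The kets of the class with datum `a`: `QFT|φ8.(b + 2p₁s𝟙_U), v′ + d(a,c)⟩`, indexed by `(s,c)`.
[cite: ChenQuantumLattice2024, §3.5.9 pp. 35–37] -/
noncomputable def datumKet (U : Finset (Fin (n + 1))) (bk b v' : Fin (n + 1) → ℤ) (a : ZQ Q)
    (sc : (Fin (n + 1) → ZQ Q) × (Fin (n + 1) → ZQ Q)) : (Fin (n + 1) → ZN D p₁ Q) → ℂ :=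
  qft (phi8bKet n D p₁ Q (b + secretShift n p₁ Q U sc.1) (v' + classShift n D p₁ Q U bk a sc.2))

/-- The Gram matrix of the kets with datum `a` is `datumGram a`. [folklore] -/
theorem ketGram_datumKet (U : Finset (Fin (n + 1))) (bk b v' : Fin (n + 1) → ℤ) (a : ZQ Q)
    (u u' : Fin (n + 1) → ZN D p₁ Q) :
    ketGram (datumKet n D p₁ Q U bk b v' a) u u' = datumGram n D p₁ Q U bk b v' a u u' := by
  unfold ketGram datumKet datumGram fourierGram
  rw [Fintype.sum_prod_type]

/-- The total weight of the class: `Σ_a Σ_{s,c} ‖datumKet a (s,c)‖² = Q·(Q^{n+1}·Q^{n+1}·P)·N^{n+1}`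
(odd `P`: every member has the flat spectrum of weight `P` on each of the `N^{n+1}` outcomes).
[cite: ChenQuantumLattice2024, §3.5.9 p. 35] -/
theorem datum_totalWeight (hP : Odd ((p₁ * Q : ℕ+) : ℕ)) (U : Finset (Fin (n + 1)))
    (bk b v' : Fin (n + 1) → ℤ) :
    ∑ a : ZQ Q, ∑ sc, star (datumKet n D p₁ Q U bk b v' a sc) ⬝ᵥ datumKet n D p₁ Q U bk b v' a sc
      = ((((Q : ℕ+) : ℕ) * (((Q : ℕ+) : ℕ) ^ (n + 1) * ((Q : ℕ+) : ℕ) ^ (n + 1) * ((p₁ * Q : ℕ+) : ℕ))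
          * ((D * D * (p₁ * Q) : ℕ+) : ℕ) ^ (n + 1) : ℕ) : ℂ) := by
  have hdiag : ∀ a : ZQ Q, ∀ sc : (Fin (n + 1) → ZQ Q) × (Fin (n + 1) → ZQ Q),
      star (datumKet n D p₁ Q U bk b v' a sc) ⬝ᵥ datumKet n D p₁ Q U bk b v' a sc
        = ∑ u : Fin (n + 1) → ZN D p₁ Q, ((((p₁ * Q : ℕ+) : ℕ) : ℂ)) := by
    intro a sc
    simp only [dotProduct, Pi.star_apply, Complex.star_def]
    refine Finset.sum_congr rfl fun u _ => ?_
    rw [mul_comm]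
    exact fourierGram_self n D p₁ Q hP _ _ u
  simp only [hdiag, Finset.sum_const, Finset.card_univ, Fintype.card_fun, Fintype.card_prod, ZMod.card,
    Fintype.card_fin, nsmul_eq_mul]
  push_cast
  ring

/-- **T10 (datum privacy, weight form).**  For EVERY POVM `E` on the Step-9 register with outcomes in
`ℤ_Q` (a guess of the datum), if `P` is odd (Cond. C.3), the total Born weight of a correct
guess over the class is at most `Q^{n+1}·Q^{n+1}·P·(#generic + Q·#non-generic)`: on generic outcomes the
measured state does not depend on the datum (only the blind `1/Q` survives completeness), on the
non-generic ones nothing better than the full weight per outcome is possible.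
[cite: ChenQuantumLattice2024, §3.5.9 pp. 35–37; NielsenChuang2010, §2.2.6 p. 90] -/
theorem datum_weight_le (hP : Odd ((p₁ * Q : ℕ+) : ℕ)) (U : Finset (Fin (n + 1)))
    (bk b v' : Fin (n + 1) → ℤ) (hbk : ∀ i, i ∉ U → bk i = b i)
    (E : POVM (Fin (n + 1) → ZN D p₁ Q) (ZQ Q)) :
    ∑ a, ∑ sc, E.weight (datumKet n D p₁ Q U bk b v' a sc) a
      ≤ (((((Q : ℕ+) : ℕ) ^ (n + 1) * ((Q : ℕ+) : ℕ) ^ (n + 1) * ((p₁ * Q : ℕ+) : ℕ))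
          * (Nat.card {u : Fin (n + 1) → ZN D p₁ Q // IsGeneric n D p₁ Q U u}
              + ((Q : ℕ+) : ℕ) * Nat.card {u : Fin (n + 1) → ZN D p₁ Q // ¬ IsGeneric n D p₁ Q U u}) : ℕ) : ℂ) := by
  classical
  have h := E.sum_weight_le_of_blocks (datumKet n D p₁ Q U bk b v') (IsGeneric n D p₁ Q U) 0
    (fun a x x' hx _ => by
      rw [ketGram_datumKet, ketGram_datumKet]
      exact datumGram_indep n D p₁ Q U bk b v' hbk (isUnit_four_of_odd p₁ Q hP) hx a 0 x')
    (fun a x x' hx hx' => by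
      rw [ketGram_datumKet]
      exact datumGram_offBlock n D p₁ Q U bk b v' a (fun hiff => hx' (hiff.1 hx)))
  refine h.trans (le_of_eq ?_)
  simp only [ketGram_datumKet, datumGram_self n D p₁ Q hP, Finset.sum_const, Finset.card_univ, ZMod.card,
    nsmul_eq_mul, Nat.card_eq_fintype_card, Fintype.card_subtype]
  push_cast
  ring

/-- **T10 (datum privacy, probability form).**  Normalising by the total weight of the class
(`datum_totalWeight`): when the datum `a ∈ ℤ_Q`, the secret shift `s` and the offset shift `c` are
uniform, EVERY measurement of the Step-9 register guesses `a` correctly with probability at most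
`1/Q + (1 − 1/Q)·π_B`, `π_B = #{non-generic u}/N^{n+1}` — advantage over the blind guess at most
`(1 − 1/Q)·π_B` (`P` odd, Cond. C.3).
[cite: ChenQuantumLattice2024, §3.5.9 pp. 35–37; NielsenChuang2010, Box 2.3 p. 87] -/
theorem datum_success_prob_le (hP : Odd ((p₁ * Q : ℕ+) : ℕ)) (U : Finset (Fin (n + 1)))
    (bk b v' : Fin (n + 1) → ℤ) (hbk : ∀ i, i ∉ U → bk i = b i)
    (E : POVM (Fin (n + 1) → ZN D p₁ Q) (ZQ Q)) :
    (∑ a, ∑ sc, E.weight (datumKet n D p₁ Q U bk b v' a sc) a).re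
        / (∑ a : ZQ Q, ∑ sc,
            star (datumKet n D p₁ Q U bk b v' a sc) ⬝ᵥ datumKet n D p₁ Q U bk b v' a sc).re
      ≤ 1 / ((Q : ℕ+) : ℕ)
        + (1 - 1 / ((Q : ℕ+) : ℕ))
          * ((Nat.card {u : Fin (n + 1) → ZN D p₁ Q // ¬ IsGeneric n D p₁ Q U u} : ℝ)
              / (((D * D * (p₁ * Q) : ℕ+) : ℕ) : ℝ) ^ (n + 1)) := by
  classical
  set K : ℕ := ((Q : ℕ+) : ℕ) ^ (n + 1) * ((Q : ℕ+) : ℕ) ^ (n + 1) * ((p₁ * Q : ℕ+) : ℕ) with hK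
  set g : ℕ := Nat.card {u : Fin (n + 1) → ZN D p₁ Q // IsGeneric n D p₁ Q U u} with hg
  set m : ℕ := Nat.card {u : Fin (n + 1) → ZN D p₁ Q // ¬ IsGeneric n D p₁ Q U u} with hm
  set Nn : ℕ := ((D * D * (p₁ * Q) : ℕ+) : ℕ) ^ (n + 1) with hNn
  have hgm : g + m = Nn := by
    rw [hg, hm, hNn, Nat.card_eq_fintype_card, Nat.card_eq_fintype_card, Fintype.card_subtype_compl,
      add_tsub_cancel_of_le (Fintype.card_subtype_le _), Fintype.card_fun, ZMod.card, Fintype.card_fin]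
  have hKpos : (0 : ℝ) < K := by
    rw [hK]
    positivity
  have hQpos : (0 : ℝ) < ((Q : ℕ+) : ℕ) := by exact_mod_cast PNat.pos Q
  have hNpos : (0 : ℝ) < Nn := by
    rw [hNn]
    positivity
  have hnum : (∑ a, ∑ sc, E.weight (datumKet n D p₁ Q U bk b v' a sc) a).re
      ≤ ((K * (g + ((Q : ℕ+) : ℕ) * m) : ℕ) : ℝ) := by
    have h := (Complex.le_def.1 (datum_weight_le n D p₁ Q hP U bk b v' hbk E)).1
    rwa [Complex.natCast_re] at h
  have hden : (∑ a : ZQ Q, ∑ sc, star (datumKet n D p₁ Q U bk b v' a sc)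
      ⬝ᵥ datumKet n D p₁ Q U bk b v' a sc).re = ((((Q : ℕ+) : ℕ) * K * Nn : ℕ) : ℝ) := by
    rw [datum_totalWeight n D p₁ Q hP, Complex.natCast_re]
  rw [hden]
  have hg' : (g : ℝ) = (Nn : ℝ) - m := by
    rw [← hgm]
    push_cast
    ring
  have hNn' : (Nn : ℝ) = (((D * D * (p₁ * Q) : ℕ+) : ℕ) : ℝ) ^ (n + 1) := by
    rw [hNn, Nat.cast_pow]
  calc (∑ a, ∑ sc, E.weight (datumKet n D p₁ Q U bk b v' a sc) a).re / ((((Q : ℕ+) : ℕ) * K * Nn : ℕ) : ℝ)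
      ≤ ((K * (g + ((Q : ℕ+) : ℕ) * m) : ℕ) : ℝ) / ((((Q : ℕ+) : ℕ) * K * Nn : ℕ) : ℝ) :=
        div_le_div_of_nonneg_right hnum (by positivity)
    _ = 1 / ((Q : ℕ+) : ℕ) + (1 - 1 / ((Q : ℕ+) : ℕ)) * ((m : ℝ) / (Nn : ℝ)) := by
        push_cast
        rw [hg']
        field_simp
        ring
    _ = 1 / ((Q : ℕ+) : ℕ)
        + (1 - 1 / ((Q : ℕ+) : ℕ))
          * ((m : ℝ) / (((D * D * (p₁ * Q) : ℕ+) : ℕ) : ℝ) ^ (n + 1)) := by rw [hNn']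

/-- **T10, worst case over the class.**  Every member of the class has squared norm `P·N^{n+1}` (T3), so
for EVERY POVM `E` some member `(a, (s, c))` has Born weight of the correct guess at most
`(1/Q + (1 − 1/Q)·π_B)·P·N^{n+1}`: no measurement of the Step-9 register outputs the datum with probability
above the bound on EVERY instance of the class (the worst-case phrasing of Part 1's read-out bound
`Shape.step9Needs_readout_le` for the Step-8 register). [cite: ChenQuantumLattice2024, §3.5.9 pp. 35–37] -/
theorem datum_exists_member_le (hP : Odd ((p₁ * Q : ℕ+) : ℕ)) (U : Finset (Fin (n + 1)))
    (bk b v' : Fin (n + 1) → ℤ) (hbk : ∀ i, i ∉ U → bk i = b i)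
    (E : POVM (Fin (n + 1) → ZN D p₁ Q) (ZQ Q)) :
    ∃ a : ZQ Q, ∃ sc : (Fin (n + 1) → ZQ Q) × (Fin (n + 1) → ZQ Q),
      (E.weight (datumKet n D p₁ Q U bk b v' a sc) a).re
        ≤ (1 / ((Q : ℕ+) : ℕ)
              + (1 - 1 / ((Q : ℕ+) : ℕ))
                * ((Nat.card {u : Fin (n + 1) → ZN D p₁ Q // ¬ IsGeneric n D p₁ Q U u} : ℝ)
                    / (((D * D * (p₁ * Q) : ℕ+) : ℕ) : ℝ) ^ (n + 1)))
          * (((((p₁ * Q : ℕ+) : ℕ) * ((D * D * (p₁ * Q) : ℕ+) : ℕ) ^ (n + 1) : ℕ) : ℝ)) := by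
  classical
  obtain ⟨β, hβ⟩ : ∃ β : ℝ, β = 1 / ((Q : ℕ+) : ℕ)
      + (1 - 1 / ((Q : ℕ+) : ℕ))
        * ((Nat.card {u : Fin (n + 1) → ZN D p₁ Q // ¬ IsGeneric n D p₁ Q U u} : ℝ)
            / (((D * D * (p₁ * Q) : ℕ+) : ℕ) : ℝ) ^ (n + 1)) := ⟨_, rfl⟩
  obtain ⟨W, hW⟩ : ∃ W : ℝ,
      W = (((((p₁ * Q : ℕ+) : ℕ) * ((D * D * (p₁ * Q) : ℕ+) : ℕ) ^ (n + 1) : ℕ) : ℝ)) := ⟨_, rfl⟩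
  rw [← hβ, ← hW]
  have htot : (∑ a : ZQ Q, ∑ sc, star (datumKet n D p₁ Q U bk b v' a sc)
      ⬝ᵥ datumKet n D p₁ Q U bk b v' a sc).re
        = (Fintype.card (ZQ Q × ((Fin (n + 1) → ZQ Q) × (Fin (n + 1) → ZQ Q))) : ℝ) * W := by
    rw [datum_totalWeight n D p₁ Q hP U bk b v', Complex.natCast_re, hW]
    simp only [Fintype.card_prod, Fintype.card_fun, ZMod.card, Fintype.card_fin]
    push_cast
    ring
  have hWpos : 0 < W := by
    rw [hW]
    positivity
  have hpos : 0 < (∑ a : ZQ Q, ∑ sc, star (datumKet n D p₁ Q U bk b v' a sc)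
      ⬝ᵥ datumKet n D p₁ Q U bk b v' a sc).re := by
    rw [htot]
    positivity
  have h := datum_success_prob_le n D p₁ Q hP U bk b v' hbk E
  rw [← hβ, div_le_iff₀ hpos, htot] at h
  have hsum : (∑ a, ∑ sc, E.weight (datumKet n D p₁ Q U bk b v' a sc) a).re
      = ∑ p : ZQ Q × ((Fin (n + 1) → ZQ Q) × (Fin (n + 1) → ZQ Q)),
          (E.weight (datumKet n D p₁ Q U bk b v' p.1 p.2) p.1).re := by
    rw [Complex.re_sum, Fintype.sum_prod_type]
    simp only [Complex.re_sum]
  rw [hsum] at h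
  have h' : ∑ p : ZQ Q × ((Fin (n + 1) → ZQ Q) × (Fin (n + 1) → ZQ Q)),
        (E.weight (datumKet n D p₁ Q U bk b v' p.1 p.2) p.1).re
      ≤ ∑ _p : ZQ Q × ((Fin (n + 1) → ZQ Q) × (Fin (n + 1) → ZQ Q)), β * W := by
    refine h.trans (le_of_eq ?_)
    rw [Finset.sum_const, Finset.card_univ, nsmul_eq_mul]
    ring
  obtain ⟨p, -, hp⟩ := Finset.exists_le_of_sum_le Finset.univ_nonempty h'
  exact ⟨p.1, p.2, hp⟩

/-! ### 4. Prime `Q`: the non-generic outcomes have density `Q^{-#U}` -/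

/-- `Q ∣ N` for `N = D²p₁Q`. [folklore] -/
theorem Q_dvd_N : ((Q : ℕ+) : ℕ) ∣ ((D * D * (p₁ * Q) : ℕ+) : ℕ) :=
  ⟨D * D * p₁, by push_cast; ring⟩

/-- `(· mod P) mod Q` is the reduction `ℤ_N → ℤ_Q`. [folklore] -/
theorem toQ_toP_eq_castHom (x : ZN D p₁ Q) :
    toQ p₁ Q (toP D (p₁ * Q) x) = ZMod.castHom (Q_dvd_N D p₁ Q) (ZQ Q) x := by
  have h : (toQ p₁ Q).comp (toP D (p₁ * Q)) = ZMod.castHom (Q_dvd_N D p₁ Q) (ZQ Q) :=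
    Subsingleton.elim _ _
  exact DFunLike.congr_fun h x

/-- The residues `≡ 0 (mod Q)` in `ℤ_N` number `N/Q`. [folklore] -/
theorem card_ker_mul_Q :
    Nat.card {x : ZN D p₁ Q // toQ p₁ Q (toP D (p₁ * Q) x) = 0} * ((Q : ℕ+) : ℕ)
      = ((D * D * (p₁ * Q) : ℕ+) : ℕ) := by
  classical
  rw [Nat.card_eq_fintype_card, Fintype.card_subtype]
  simp_rw [toQ_toP_eq_castHom]
  exact card_filter_castHom_mul (Q_dvd_N D p₁ Q) 0

/-- For prime `Q`, `u` is non-generic iff `u_i ≡ 0 (mod Q)` for every `i ∈ U`. [folklore] -/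
theorem not_isGeneric_iff_of_prime [Fact (Nat.Prime ((Q : ℕ+) : ℕ))] (U : Finset (Fin (n + 1)))
    (u : Fin (n + 1) → ZN D p₁ Q) :
    ¬ IsGeneric n D p₁ Q U u ↔ ∀ i, i ∈ U → toQ p₁ Q (toP D (p₁ * Q) (u i)) = 0 := by
  unfold IsGeneric
  push Not
  refine forall₂_congr fun i hi => ?_
  unfold classFreq
  rw [if_pos hi, isUnit_iff_ne_zero, not_not]

/-- **Density of the non-generic outcomes, prime `Q`**: `#{u : no u_i (i ∈ U) is a unit mod Q}·Q^{#U}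
= N^{n+1}`, i.e. `π_B = Q^{-#U}`. [folklore] -/
theorem card_nonGeneric_mul_of_prime [Fact (Nat.Prime ((Q : ℕ+) : ℕ))] (U : Finset (Fin (n + 1))) :
    Nat.card {u : Fin (n + 1) → ZN D p₁ Q // ¬ IsGeneric n D p₁ Q U u} * ((Q : ℕ+) : ℕ) ^ U.card
      = ((D * D * (p₁ * Q) : ℕ+) : ℕ) ^ (n + 1) := by
  classical
  have h1 : Nat.card {u : Fin (n + 1) → ZN D p₁ Q // ¬ IsGeneric n D p₁ Q U u}
      = Nat.card {u : Fin (n + 1) → ZN D p₁ Q //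
          ∀ i, i ∈ U → toQ p₁ Q (toP D (p₁ * Q) (u i)) = 0} :=
    Nat.card_congr (Equiv.subtypeEquivRight fun u => not_isGeneric_iff_of_prime n D p₁ Q U u)
  have h2 : Nat.card {u : Fin (n + 1) → ZN D p₁ Q //
        ∀ i, i ∈ U → toQ p₁ Q (toP D (p₁ * Q) (u i)) = 0}
      = ∏ i : Fin (n + 1), Nat.card {x : ZN D p₁ Q // i ∈ U → toQ p₁ Q (toP D (p₁ * Q) x) = 0} := by
    rw [Nat.card_congr (@Equiv.subtypePiEquivPi (Fin (n + 1)) (fun _ => ZN D p₁ Q)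
      (fun i x => i ∈ U → toQ p₁ Q (toP D (p₁ * Q) x) = 0)), Nat.card_pi]
  have h3 : ∀ i : Fin (n + 1),
      Nat.card {x : ZN D p₁ Q // i ∈ U → toQ p₁ Q (toP D (p₁ * Q) x) = 0}
        * (if i ∈ U then ((Q : ℕ+) : ℕ) else 1) = ((D * D * (p₁ * Q) : ℕ+) : ℕ) := by
    intro i
    by_cases hi : i ∈ U
    · rw [if_pos hi, Nat.card_congr (Equiv.subtypeEquivRight (fun x => ⟨fun h => h hi, fun h _ => h⟩) :
        {x : ZN D p₁ Q // i ∈ U → toQ p₁ Q (toP D (p₁ * Q) x) = 0}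
          ≃ {x : ZN D p₁ Q // toQ p₁ Q (toP D (p₁ * Q) x) = 0})]
      exact card_ker_mul_Q D p₁ Q
    · rw [if_neg hi, mul_one, Nat.card_congr (Equiv.subtypeUnivEquiv (fun x h => absurd h hi) :
        {x : ZN D p₁ Q // i ∈ U → toQ p₁ Q (toP D (p₁ * Q) x) = 0} ≃ ZN D p₁ Q),
        Nat.card_eq_fintype_card, ZMod.card]
  have h4 : ((Q : ℕ+) : ℕ) ^ U.card = ∏ i : Fin (n + 1), (if i ∈ U then ((Q : ℕ+) : ℕ) else 1) := by
    rw [Finset.prod_ite_mem, Finset.univ_inter, Finset.prod_const]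
  rw [h1, h2, h4, ← Finset.prod_mul_distrib, Finset.prod_congr rfl fun i _ => h3 i, Finset.prod_const,
    Finset.card_univ, Fintype.card_fin]

/-- **T10 for prime `Q`**: every measurement of the Step-9 register guesses the datum with probability at
most `1/Q + (1 − 1/Q)/Q^m`, `m = #U` the number of unknown coordinates (odd `P`).  This is SHARP
(attained by the measurement that reads `ū` and, on `ū|_U = 0`, discriminates the `Q` orthogonal states
of the block — remark, not formalised).
[cite: ChenQuantumLattice2024, §3.5.9 pp. 35–37; NielsenChuang2010, Box 2.3 p. 87] -/
theorem datum_success_prob_le_of_prime [Fact (Nat.Prime ((Q : ℕ+) : ℕ))]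
    (hP : Odd ((p₁ * Q : ℕ+) : ℕ)) (U : Finset (Fin (n + 1))) (bk b v' : Fin (n + 1) → ℤ)
    (hbk : ∀ i, i ∉ U → bk i = b i) (E : POVM (Fin (n + 1) → ZN D p₁ Q) (ZQ Q)) :
    (∑ a, ∑ sc, E.weight (datumKet n D p₁ Q U bk b v' a sc) a).re
        / (∑ a : ZQ Q, ∑ sc,
            star (datumKet n D p₁ Q U bk b v' a sc) ⬝ᵥ datumKet n D p₁ Q U bk b v' a sc).re
      ≤ 1 / ((Q : ℕ+) : ℕ) + (1 - 1 / ((Q : ℕ+) : ℕ)) / (((Q : ℕ+) : ℕ) : ℝ) ^ U.card := by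
  have h := datum_success_prob_le n D p₁ Q hP U bk b v' hbk E
  have hc := card_nonGeneric_mul_of_prime n D p₁ Q U
  have hfrac : (Nat.card {u : Fin (n + 1) → ZN D p₁ Q // ¬ IsGeneric n D p₁ Q U u} : ℝ)
      / (((D * D * (p₁ * Q) : ℕ+) : ℕ) : ℝ) ^ (n + 1) = 1 / (((Q : ℕ+) : ℕ) : ℝ) ^ U.card := by
    rw [div_eq_div_iff (by positivity) (by positivity), one_mul, ← Nat.cast_pow, ← Nat.cast_pow,
      ← Nat.cast_mul, hc]
  rwa [hfrac, mul_one_div] at h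

end Datum

end Literature.Computability.Cryptography.Chen2024

/-! ### 5. The `Steps` rendering: T10 for every admissible shape -/

namespace Literature.Computability.Cryptography.Chen2024.Shape

open scoped BigOperators ComplexOrder
open Matrix

variable (S : Shape)

/-- **T10 for every admissible shape.**  Let `U` be any set of coordinates (the unknown ones), `bk` any
public vector agreeing with `S.b` off `U`, `v′` any offset, and `E` ANY general measurement (POVM) of the
Step-9 register `ℤ_N^{n+1}` (after `QFT`) with outcomes in `ℤ_Q`.  With the datum `a`, the secret shift
`s ∈ ℤ_Q^{n+1}` and the offset shift `c ∈ ℤ_Q^{n+1}` uniform, `E` outputs `a` with probability at most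
`1/Q + (1 − 1/Q)·π_B`, `π_B = #{u : no u_i mod Q (i ∈ U) is a unit}/N^{n+1}` (C.3 makes `P` odd).
[cite: ChenQuantumLattice2024, §3.5.9 pp. 35–37, Cond. C.3 p. 18, eq. (12) p. 17] -/
theorem datum_privacy (h : S.Admissible) (U : Finset (Fin (S.n + 1))) (bk : Fin (S.n + 1) → ℤ)
    (hbk : ∀ i, i ∉ U → bk i = S.b i) (v' : Fin (S.n + 1) → ℤ)
    (E : POVM (Fin (S.n + 1) → ZN S.D S.p₁ S.Q) (ZQ S.Q)) :
    (∑ a, ∑ sc, E.weight (datumKet S.n S.D S.p₁ S.Q U bk S.b v' a sc) a).re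
        / (∑ a : ZQ S.Q, ∑ sc, star (datumKet S.n S.D S.p₁ S.Q U bk S.b v' a sc)
            ⬝ᵥ datumKet S.n S.D S.p₁ S.Q U bk S.b v' a sc).re
      ≤ 1 / (S.Q : ℕ)
        + (1 - 1 / (S.Q : ℕ))
          * ((Nat.card {u : Fin (S.n + 1) → ZN S.D S.p₁ S.Q // ¬ IsGeneric S.n S.D S.p₁ S.Q U u} : ℝ)
              / ((S.N : ℕ) : ℝ) ^ (S.n + 1)) :=
  datum_success_prob_le S.n S.D S.p₁ S.Q h.odd_P U bk S.b v' hbk E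

/-- **T10 for every admissible shape with `Q` prime** (`κ = 2`): the bound is `1/Q + (1 − 1/Q)/Q^{#U}`.
[cite: ChenQuantumLattice2024, §3.5.9 pp. 35–37, Cond. C.3 p. 18] -/
theorem datum_privacy_of_prime (h : S.Admissible) [Fact (Nat.Prime (S.Q : ℕ))]
    (U : Finset (Fin (S.n + 1))) (bk : Fin (S.n + 1) → ℤ) (hbk : ∀ i, i ∉ U → bk i = S.b i)
    (v' : Fin (S.n + 1) → ℤ) (E : POVM (Fin (S.n + 1) → ZN S.D S.p₁ S.Q) (ZQ S.Q)) :
    (∑ a, ∑ sc, E.weight (datumKet S.n S.D S.p₁ S.Q U bk S.b v' a sc) a).re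
        / (∑ a : ZQ S.Q, ∑ sc, star (datumKet S.n S.D S.p₁ S.Q U bk S.b v' a sc)
            ⬝ᵥ datumKet S.n S.D S.p₁ S.Q U bk S.b v' a sc).re
      ≤ 1 / (S.Q : ℕ) + (1 - 1 / (S.Q : ℕ)) / ((S.Q : ℕ) : ℝ) ^ U.card :=
  datum_success_prob_le_of_prime S.n S.D S.p₁ S.Q h.odd_P U bk S.b v' hbk E

end Literature.Computability.Cryptography.Chen2024.Shape
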